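/-
Copyright (c) 2026. All rights reserved.
Released under Apache 2.0 license as described in the file LICENSE.
-/
import Literature.Computability.Cryptography.RegevSamplerStageDesc
import Literature.Computability.QuantumComplexity.GRBlockWordTabFP

/-!
# The table sampler's Grover–Rudolph STAGE word on codes

`RegevSamplerStageDesc.map_toAG_grStage_std` abstracts the machine's Grover–Rudolph stage to
`(finRange n).flatMap fun i => blockWord.map (AGmap (embA 0 ℓ base B i))`; `GRBlockWordTabFP` puts the table
sampler's block word on codes from `ℓ, np, k+1` in unary.  Here the two are composed: the stage word on codes from a
context giving `n, ℓ, np, k+1` in unary and the zone base in binary (`grStageAN_codeFP_of`), the block width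
`GRData.B` being computed (`KitParamsFP.bsize_GR_codeFP`, `GRWlenFP.wlen_codeFP_of`); the `finRange` form of
`map_toAG_grStage_std` is `SimTokens.finRange_flatMap_val`.
[cite: Regev2009, Lemma 3.14 (proof)] [cite: AroraBarak2009, §6.2 (proof of Thm. 6.15)]

HONEST FRAMING: the VALUE is a THEOREM (kernel-checked lemmas of a KNOWN reduction, Regev 2009) — NOT summit progress.
-/

noncomputable section

namespace Literature.Computability.Cryptography.Regev2009.SamplerRegs

open _root_.Computability Literature.Computability.QuantumComplexity Literature.Computability.QuantumComplexity.AJLCore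
  Literature.Computability.Complexity Literature.Computability.Complexity.CodeFP

variable {σ : Type} {eσ : σ → List Bool}

/-- The Grover–Rudolph block width `GRData.B ℓ np wlen (k+1)` of the table sampler in unary on codes.
[cite: Regev2009, Lemma 3.14 (proof)] [cite: AroraBarak2009, §6.2 (proof of Thm. 6.15)] -/
theorem grB_codeFP_of (τ : LevelCode) {ℓ np kk : σ → ℕ} (hℓ : CodeFP eσ unE ℓ) (hnp : CodeFP eσ unE np)
    (hk : CodeFP eσ unE kk) :
    CodeFP eσ unE (fun c => GRData.B (ℓ c) (np c) (GRTableMach.wlen τ (ℓ c) (np c)) (kk c)) :=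
  (GenKit.bsize_GR_codeFP (BP.uadd (BP.uadd hℓ hnp) (GRTableMach.wlen_codeFP_of τ hℓ hnp)) hk).congr fun _ => rfl

/-- **The table sampler's Grover–Rudolph stage word on codes**: `n` copies of the block word, copy `i` renamed by
`embA 0 ℓ base B i`, from `n, ℓ, np, k+1` in unary and `base` in binary. [cite: Regev2009, Lemma 3.14 (proof)]
[cite: AroraBarak2009, §6.2 (proof of Thm. 6.15)] -/
theorem grStageAN_codeFP_of (τ : LevelCode) {n ℓ np kk base : σ → ℕ} (hn : CodeFP eσ unE n)
    (hℓ : CodeFP eσ unE ℓ) (hnp : CodeFP eσ unE np) (hk : CodeFP eσ unE kk) (hbase : CodeFP eσ natE base) :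
    CodeFP eσ (rawE agE0) (fun c => (List.range (n c)).flatMap fun i =>
      (GRStage.blockAN (GRTableMach.cosE τ) (GRTableMach.cosM τ) (ℓ c) (np c) (GRTableMach.wlen τ (ℓ c) (np c)) (kk c)
          (GRCosineMach.v (np c))).map
        (AGmap (embA 0 (ℓ c) (base c) (GRData.B (ℓ c) (np c) (GRTableMach.wlen τ (ℓ c) (np c)) (kk c)) i))) := by
  have hblock := GRTableMach.blockAN_codeFP_of τ hℓ hnp hk
  have hf := embA_codeFP_of (const _ 0) (BP.toNat hℓ) hbase (BP.toNat (grB_codeFP_of τ hℓ hnp hk))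
  have hF : CodeFP (pairE eσ natE) (rawE agE0) (fun q =>
      (GRStage.blockAN (GRTableMach.cosE τ) (GRTableMach.cosM τ) (ℓ q.1) (np q.1) (GRTableMach.wlen τ (ℓ q.1) (np q.1))
          (kk q.1) (GRCosineMach.v (np q.1))).map
        (AGmap (embA 0 (ℓ q.1) (base q.1) (GRData.B (ℓ q.1) (np q.1) (GRTableMach.wlen τ (ℓ q.1) (np q.1)) (kk q.1)) q.2))) :=
    ((mapAGmap_codeFP (σ := σ × ℕ) (f := fun q w =>
        embA 0 (ℓ q.1) (base q.1) (GRData.B (ℓ q.1) (np q.1) (GRTableMach.wlen τ (ℓ q.1) (np q.1)) (kk q.1)) q.2 w) hf).comp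
      ((CodeFP.id _).pair (hblock.comp (fst _ _))) :)
  exact UExec.flatMapRange hn hF

end Literature.Computability.Cryptography.Regev2009.SamplerRegs

end
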